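import Summits.CriticalPhenomena.PercolationContinuityZ3.Theorems.PercNearOneGluingNoHeavyLowerTailFatMinorityDominantRelay
import HarnessLib

/-!
# `NoHeavyLowerTail` (stmt-CriticalPhenomena-4575), line fat-minority-linear — the ANCHORED-RELAY
# class of the stub `stub_fatMinorityLinear` (sharpening of `…FatMinorityDominantRelay`):
# the stub holds unless the observer is a HUB

Relay set `A`, observer `o ∉ A`, `N = #{a ∈ A : o ↔ a}`, `η ≥ max_{a,a'} P(a ↮ a')`,
`U = {o ↔ A}`, `D = {o ↮ a₀}`.  Say the relay `a₀ ∈ A` *`θ`-anchors* `o` if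
`P(o ↔ A, o ↮ a₀) ≤ θ · P(o ↮ a₀)` — equivalently `P(o ↮ A) ≥ (1 − θ) · P(o ↮ a₀)`: missing the
whole relay set is at least `(1−θ)` times as likely as missing `a₀`.  File
`…FatMinorityDominantRelay` proved the stub for `2θ < 1` (Markov at `|A|/2`); here the Markov
step is removed by feeding BHK the INDICATOR of "the cluster of `a₀` holds a strict majority of the
relays" (an increasing function of `C_{a₀}`), which gives the stub for EVERY `θ < 1`:

* `reachSet_majority_negCorr` — BHK 2006 Thm. 1.4: `μ(D) μ(D ∩ U ∩ Maj_{a₀}) ≤ μ(D ∩ U) μ(D ∩ Maj_{a₀})`,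
  `Maj_{a₀} = {|A| < 2 · #{a ∈ A : a₀ ↔ a}}`.
* `fatMinority_anchoredRelay` — if `a₀` `θ`-anchors `o` (`0 ≤ θ`) then
  `(1 − θ) · P(1 ≤ N ∧ 2N ≤ |A|) ≤ 2η + θ · P(o ↮ A)`.
  Proof: `F ⊆ Maj_{a₀}ᶜ ∪ (D ∩ U ∩ Maj_{a₀})`; `μ(Maj_{a₀}ᶜ) ≤ 2η` (counting); by BHK
  `x := μ(D ∩ U ∩ Maj) ≤ θ μ(D ∩ Maj) ≤ θ μ(D) = θ (μ(Uᶜ) + μ(D ∩ U)) ≤ θ (μ(Uᶜ) + x + 2η)`.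
* `fatMinority_anchoredRelay_ratio` — ratio form: if `P(o ↮ a₀) ≤ R · P(o ↮ A)` for some
  `a₀ ∈ A`, `1 ≤ R`, then `P(d₀ < N ∧ 2N ≤ |A|) ≤ R · (2η + P(o ↮ A))`.

Reading (the residual, sharpened once more).  The fat-minority stub — hence linear gluing, the
linear lower-tail form and one-cut up to constants — holds for every observer possessing ONE
relay `a₀` with `P(o ↮ a₀) ≤ R · P(o ↮ A)` (constant `∝ R`).  What is left is the HUB regime:
`P(o ↮ a) ≫ P(o ↮ A)` for EVERY relay `a` — the observer reaches the relay set far more reliably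
than any single relay (many weak, nearly independent entrances; the "Family X" geometry of the
line's notes), where the expected mechanism is concentration of `N`, not anchoring.
-/

noncomputable section

namespace Summit.CriticalPhenomena.PercolationContinuityZ3.Theorems

open MeasureTheory Set Literature.Probability.LatticeModels Literature.Probability.Percolation
open Literature.Probability.Percolation.TripodExchange
open scoped Classical BigOperators

/-- **BHK 2006, Thm. 1.4, for the reach of the relay set and the majority of `a₀`'s cluster.**
With `D = {o ↮ a₀}`, `U = {o ↔ A}`, `Maj = {|A| < 2 · #{a ∈ A : a₀ ↔ a}}`:
`μ(D) · μ(D ∩ (U ∩ Maj)) ≤ μ(D ∩ U) · μ(D ∩ Maj)` (`1_U` is increasing in the edge cluster of `o`,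
`1_Maj` in that of `a₀`). [cite: VandenbergHaggstromKahn2005, Thm. 1.4 (p. 7)] -/
theorem reachSet_majority_negCorr {n : ℕ} (w : Sym2 (Fin n) → unitInterval) (A : Finset (Fin n))
    (o a₀ : Fin n) (hne : o ≠ a₀) :
    (prodBernoulli w).real (openConn o a₀ : Set (BondConfig (Fin n)))ᶜ *
        (prodBernoulli w).real ((openConn o a₀ : Set (BondConfig (Fin n)))ᶜ ∩
          ((⋃ a' ∈ A, (openConn o a' : Set (BondConfig (Fin n)))) ∩
            {ω : BondConfig (Fin n) | A.card < 2 * (A.filter fun a => ω ∈ openConn a₀ a).card})) ≤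
      (prodBernoulli w).real ((openConn o a₀ : Set (BondConfig (Fin n)))ᶜ ∩
          (⋃ a' ∈ A, (openConn o a' : Set (BondConfig (Fin n))))) *
        (prodBernoulli w).real ((openConn o a₀ : Set (BondConfig (Fin n)))ᶜ ∩
          {ω : BondConfig (Fin n) | A.card < 2 * (A.filter fun a => ω ∈ openConn a₀ a).card}) := by
  -- `F(C) = 1{some relay is o or touches C}` and `G(C) = 1{#{a : a = a₀ or a touches C} > |A|/2}`
  have hFmono : Monotone (fun C : Set (Sym2 (Fin n)) =>
      if ∃ a' ∈ A, (a' = o ∨ ∃ e ∈ C, a' ∈ e) then (1 : ℝ) else 0) := by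
    intro C C' hCC'
    dsimp only
    by_cases h : ∃ a' ∈ A, (a' = o ∨ ∃ e ∈ C, a' ∈ e)
    · have h' : ∃ a' ∈ A, (a' = o ∨ ∃ e ∈ C', a' ∈ e) := by
        obtain ⟨a', ha', h⟩ := h
        exact ⟨a', ha', h.imp id fun ⟨e, he, hae⟩ => ⟨e, hCC' he, hae⟩⟩
      rw [if_pos h, if_pos h']
    · rw [if_neg h]
      split_ifs
      · exact zero_le_one
      · exact le_rfl
  have hFval : ∀ ω : BondConfig (Fin n),
      (if ∃ a' ∈ A, (a' = o ∨ ∃ e ∈ openEdgeCluster ω o, a' ∈ e) then (1 : ℝ) else 0) =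
        (⋃ a' ∈ A, (openConn o a' : Set (BondConfig (Fin n)))).indicator 1 ω := by
    intro ω
    by_cases hU : ω ∈ ⋃ a' ∈ A, (openConn o a' : Set (BondConfig (Fin n)))
    · rw [Set.indicator_of_mem hU, Pi.one_apply, if_pos]
      obtain ⟨a', ha', h⟩ := Set.mem_iUnion₂.1 hU
      exact ⟨a', ha', (reachable_iff_exists_mem_openEdgeCluster ω o a').1 h⟩
    · rw [Set.indicator_of_notMem hU, if_neg]
      rintro ⟨a', ha', h⟩
      exact hU (Set.mem_iUnion₂.2 ⟨a', ha', (reachable_iff_exists_mem_openEdgeCluster ω o a').2 h⟩)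
  have hGmono : Monotone (fun C : Set (Sym2 (Fin n)) =>
      if A.card < 2 * (A.filter fun a => a = a₀ ∨ ∃ e ∈ C, a ∈ e).card then (1 : ℝ) else 0) := by
    intro C C' hCC'
    dsimp only
    have hsub : (A.filter fun a => a = a₀ ∨ ∃ e ∈ C, a ∈ e) ⊆
        (A.filter fun a => a = a₀ ∨ ∃ e ∈ C', a ∈ e) := by
      intro a ha
      rw [Finset.mem_filter] at ha ⊢
      exact ⟨ha.1, ha.2.imp id fun ⟨e, he, hae⟩ => ⟨e, hCC' he, hae⟩⟩
    have hcard := Finset.card_le_card hsub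
    by_cases h : A.card < 2 * (A.filter fun a => a = a₀ ∨ ∃ e ∈ C, a ∈ e).card
    · rw [if_pos h, if_pos (lt_of_lt_of_le h (by omega))]
    · rw [if_neg h]
      split_ifs
      · exact zero_le_one
      · exact le_rfl
  have hGval : ∀ ω : BondConfig (Fin n),
      (if A.card < 2 * (A.filter fun a => a = a₀ ∨ ∃ e ∈ openEdgeCluster ω a₀, a ∈ e).card
        then (1 : ℝ) else 0) =
        ({ω : BondConfig (Fin n) |
          A.card < 2 * (A.filter fun a => ω ∈ openConn a₀ a).card}).indicator 1 ω := by
    intro ω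
    have hfilt : (A.filter fun a => a = a₀ ∨ ∃ e ∈ openEdgeCluster ω a₀, a ∈ e) =
        (A.filter fun a => ω ∈ openConn a₀ a) := by
      refine Finset.filter_congr fun a _ => ?_
      rw [← reachable_iff_exists_mem_openEdgeCluster ω a₀ a]
      rfl
    rw [hfilt]
    by_cases hM : A.card < 2 * (A.filter fun a => ω ∈ openConn a₀ a).card
    · have hM' : ω ∈ {ω : BondConfig (Fin n) |
          A.card < 2 * (A.filter fun a => ω ∈ openConn a₀ a).card} := hM
      rw [Set.indicator_of_mem hM', Pi.one_apply, if_pos hM]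
    · have hM' : ω ∉ {ω : BondConfig (Fin n) |
          A.card < 2 * (A.filter fun a => ω ∈ openConn a₀ a).card} := hM
      rw [Set.indicator_of_notMem hM', if_neg hM]
  have key := BHK2006_twoClusterConditionalAssociation_holds.negCorrelation (Fin n) w o a₀
    (fun C : Set (Sym2 (Fin n)) => if ∃ a' ∈ A, (a' = o ∨ ∃ e ∈ C, a' ∈ e) then (1 : ℝ) else 0)
    (fun C : Set (Sym2 (Fin n)) =>
      if A.card < 2 * (A.filter fun a => a = a₀ ∨ ∃ e ∈ C, a ∈ e).card then (1 : ℝ) else 0)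
    hFmono hGmono hne
  have hD : {ω : BondConfig (Fin n) | ¬ (openGraph ω).Reachable o a₀} =
      (openConn o a₀ : Set (BondConfig (Fin n)))ᶜ := rfl
  simp only [hD, hFval, hGval] at key
  simp only [setIntegral_indicator_one_eq, setIntegral_indicator_mul_indicator_eq] at key
  exact key

/-- **The fat-minority stub on the anchored-relay class (every `θ < 1`).**  If `a₀ ∈ A`
`θ`-anchors the observer `o ∉ A` (`P(o ↔ A, o ↮ a₀) ≤ θ · P(o ↮ a₀)`, `0 ≤ θ`) and
`P(a ↮ a') ≤ η` on `A`, then `(1 − θ) · P(1 ≤ N ∧ 2N ≤ |A|) ≤ 2η + θ · P(o ↮ A)`.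
[cite: VandenbergHaggstromKahn2005, Thm. 1.4 (p. 7)] -/
theorem fatMinority_anchoredRelay {n : ℕ} (w : Sym2 (Fin n) → unitInterval) (A : Finset (Fin n))
    (o a₀ : Fin n) (η θ : ℝ) (hθ : 0 ≤ θ) (ha₀ : a₀ ∈ A) (hoA : o ∉ A)
    (hdom : (prodBernoulli w).real ((openConn o a₀ : Set (BondConfig (Fin n)))ᶜ ∩
        (⋃ a' ∈ A, (openConn o a' : Set (BondConfig (Fin n))))) ≤
      θ * (prodBernoulli w).real (openConn o a₀ : Set (BondConfig (Fin n)))ᶜ)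
    (hpair : ∀ a ∈ A, ∀ a' ∈ A, (prodBernoulli w).real (openConn a a' : Set (BondConfig (Fin n)))ᶜ ≤ η) :
    (1 - θ) * (prodBernoulli w).real {ω : BondConfig (Fin n) |
        0 < (A.filter fun a => ω ∈ openConn o a).card ∧
          2 * (A.filter fun a => ω ∈ openConn o a).card ≤ A.card} ≤
      2 * η + θ * (prodBernoulli w).real (⋃ a' ∈ A, (openConn o a' : Set (BondConfig (Fin n))))ᶜ := by
  have hmeas : ∀ s : Set (BondConfig (Fin n)), MeasurableSet s :=
    fun _ => MeasurableSet.of_discrete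
  have hne : o ≠ a₀ := fun h => hoA (h ▸ ha₀)
  set P := prodBernoulli w with hP
  set D : Set (BondConfig (Fin n)) := (openConn o a₀ : Set (BondConfig (Fin n)))ᶜ with hD
  set U : Set (BondConfig (Fin n)) := ⋃ a' ∈ A, (openConn o a' : Set (BondConfig (Fin n))) with hU
  set Maj : Set (BondConfig (Fin n)) :=
    {ω | A.card < 2 * (A.filter fun a => ω ∈ openConn a₀ a).card} with hMaj
  set F : Set (BondConfig (Fin n)) := {ω : BondConfig (Fin n) |
      0 < (A.filter fun a => ω ∈ openConn o a).card ∧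
        2 * (A.filter fun a => ω ∈ openConn o a).card ≤ A.card} with hFdef
  set m : ℝ := (A.card : ℝ) with hm
  have hmpos : 0 < m := by rw [hm]; exact_mod_cast Finset.card_pos.2 ⟨a₀, ha₀⟩
  have hη0 : 0 ≤ η := le_trans measureReal_nonneg (hpair a₀ ha₀ a₀ ha₀)
  -- the complement of `Maj`: `a₀` misses at least half of the relays, cost `2η`
  have hMajc : P.real Majᶜ ≤ 2 * η := by
    have hc := halfLeSevenForms_mul_measureReal_le_sum_inter P A
      (fun a => (openConn a₀ a : Set (BondConfig (Fin n)))ᶜ) (fun _ _ => hmeas _) (hmeas Majᶜ)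
      (m / 2) ?_
    · have hsum : ∑ a ∈ A, P.real (Majᶜ ∩ (openConn a₀ a : Set (BondConfig (Fin n)))ᶜ) ≤ m * η := by
        calc ∑ a ∈ A, P.real (Majᶜ ∩ (openConn a₀ a : Set (BondConfig (Fin n)))ᶜ)
            ≤ ∑ a ∈ A, η := Finset.sum_le_sum fun a ha =>
              (measureReal_mono Set.inter_subset_right (measure_ne_top _ _)).trans (hpair a₀ ha₀ a ha)
          _ = m * η := by rw [Finset.sum_const, nsmul_eq_mul, hm]
      have h2 : m / 2 * P.real Majᶜ ≤ m / 2 * (2 * η) := by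
        calc m / 2 * P.real Majᶜ ≤ m * η := hc.trans hsum
          _ = m / 2 * (2 * η) := by ring
      exact le_of_mul_le_mul_left h2 (by positivity)
    intro ω hω
    have hind : ∀ a ∈ A,
        ((openConn a₀ a : Set (BondConfig (Fin n)))ᶜ).indicator (fun _ => (1 : ℝ)) ω =
          if ¬ ω ∈ (openConn a₀ a : Set (BondConfig (Fin n))) then (1 : ℝ) else 0 := by
      intro a _
      by_cases h' : ω ∈ (openConn a₀ a : Set (BondConfig (Fin n)))
      · rw [if_neg (not_not.2 h'), Set.indicator_of_notMem (Set.notMem_compl_iff.2 h')]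
      · rw [if_pos h', Set.indicator_of_mem (show ω ∈ (openConn a₀ a : Set (BondConfig (Fin n)))ᶜ
          from h')]
    rw [Finset.sum_congr rfl hind, Finset.sum_boole]
    have hω' : ¬ A.card < 2 * (A.filter fun a => ω ∈ openConn a₀ a).card := hω
    have hsplit := Finset.card_filter_add_card_filter_not (s := A)
      (fun a => ω ∈ (openConn a₀ a : Set (BondConfig (Fin n))))
    have hcast : ((A.filter fun a => ω ∈ (openConn a₀ a : Set (BondConfig (Fin n)))).card : ℝ) +
        ((A.filter fun a => ¬ ω ∈ (openConn a₀ a : Set (BondConfig (Fin n)))).card : ℝ) = m := by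
      rw [hm]; exact_mod_cast hsplit
    have hle : 2 * ((A.filter fun a => ω ∈ (openConn a₀ a : Set (BondConfig (Fin n)))).card : ℝ) ≤ m := by
      rw [hm]; exact_mod_cast le_of_not_gt hω'
    linarith
  -- cover: `F ⊆ Majᶜ ∪ (D ∩ (U ∩ Maj))`
  have hcovF : F ⊆ Majᶜ ∪ (D ∩ (U ∩ Maj)) := by
    intro ω hω
    obtain ⟨hpos, hmin⟩ := hω
    by_cases hmaj : A.card < 2 * (A.filter fun a => ω ∈ openConn a₀ a).card
    · right
      refine ⟨fun hoa₀ => ?_, ?_, hmaj⟩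
      · have hsub : (A.filter fun a => ω ∈ openConn a₀ a) ⊆ (A.filter fun a => ω ∈ openConn o a) := by
          intro a ha
          rw [Finset.mem_filter] at ha ⊢
          have h1 : (openGraph ω).Reachable o a₀ := hoa₀
          have h2 : (openGraph ω).Reachable a₀ a := ha.2
          exact ⟨ha.1, h1.trans h2⟩
        have := Finset.card_le_card hsub
        omega
      · obtain ⟨a, ha⟩ := Finset.card_pos.1 hpos
        rw [Finset.mem_filter] at ha
        exact Set.mem_biUnion (Finset.mem_coe.2 ha.1) ha.2
    · exact Or.inl hmaj
  -- `Uᶜ ⊆ D` and `D ⊆ Uᶜ ∪ (D ∩ U ∩ Maj) ∪ Majᶜ`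
  have hUc_sub : Uᶜ ⊆ D := by
    intro ω hω hoa₀
    exact hω (Set.mem_biUnion (Finset.mem_coe.2 ha₀) hoa₀)
  have hD_le : P.real D ≤ P.real Uᶜ + P.real (D ∩ (U ∩ Maj)) + P.real Majᶜ := by
    have hcov : D ⊆ (Uᶜ ∪ (D ∩ (U ∩ Maj))) ∪ Majᶜ := by
      intro ω hω
      by_cases hωU : ω ∈ U
      · by_cases hωM : ω ∈ Maj
        · exact Or.inl (Or.inr ⟨hω, hωU, hωM⟩)
        · exact Or.inr hωM
      · exact Or.inl (Or.inl hωU)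
    calc P.real D ≤ P.real ((Uᶜ ∪ (D ∩ (U ∩ Maj))) ∪ Majᶜ) := measureReal_mono hcov (measure_ne_top _ _)
      _ ≤ P.real (Uᶜ ∪ (D ∩ (U ∩ Maj))) + P.real Majᶜ := measureReal_union_le _ _
      _ ≤ P.real Uᶜ + P.real (D ∩ (U ∩ Maj)) + P.real Majᶜ := by
          have := measureReal_union_le (μ := P) Uᶜ (D ∩ (U ∩ Maj))
          linarith
  -- BHK: `μ(D) x ≤ μ(D ∩ U) μ(D ∩ Maj) ≤ θ μ(D) μ(D ∩ Maj)`, hence `x ≤ θ μ(D ∩ Maj) ≤ θ μ(D)`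
  set x : ℝ := P.real (D ∩ (U ∩ Maj)) with hx
  have hBHK := reachSet_majority_negCorr w A o a₀ hne
  have hx_le : x ≤ θ * P.real D := by
    have hDMaj : P.real (D ∩ Maj) ≤ P.real D :=
      measureReal_mono Set.inter_subset_left (measure_ne_top _ _)
    rcases (measureReal_nonneg : 0 ≤ P.real D).eq_or_lt with hD0 | hDpos
    · have : x ≤ P.real D := measureReal_mono Set.inter_subset_left (measure_ne_top _ _)
      rw [← hD0] at this ⊢
      simpa using this
    · have h1 : P.real D * x ≤ P.real D * (θ * P.real D) := by
        calc P.real D * x ≤ P.real (D ∩ U) * P.real (D ∩ Maj) := hBHK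
          _ ≤ θ * P.real D * P.real (D ∩ Maj) :=
              mul_le_mul_of_nonneg_right hdom measureReal_nonneg
          _ ≤ θ * P.real D * P.real D :=
              mul_le_mul_of_nonneg_left hDMaj (mul_nonneg hθ measureReal_nonneg)
          _ = P.real D * (θ * P.real D) := by ring
      exact le_of_mul_le_mul_left h1 hDpos
  -- assemble
  have hF_le : P.real F ≤ P.real Majᶜ + x :=
    calc P.real F ≤ P.real (Majᶜ ∪ (D ∩ (U ∩ Maj))) := measureReal_mono hcovF (measure_ne_top _ _)
      _ ≤ P.real Majᶜ + x := measureReal_union_le _ _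
  have hx2 : x ≤ θ * (P.real Uᶜ + x + 2 * η) := by
    calc x ≤ θ * P.real D := hx_le
      _ ≤ θ * (P.real Uᶜ + x + P.real Majᶜ) := mul_le_mul_of_nonneg_left hD_le hθ
      _ ≤ θ * (P.real Uᶜ + x + 2 * η) := by gcongr
  have hF0 : 0 ≤ P.real F := measureReal_nonneg
  have hUc0 : 0 ≤ P.real Uᶜ := measureReal_nonneg
  rcases le_or_gt θ 1 with hθ1 | hθ1
  · have h1 : (1 - θ) * P.real F ≤ (1 - θ) * (P.real Majᶜ + x) :=
      mul_le_mul_of_nonneg_left hF_le (sub_nonneg.2 hθ1)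
    have h2 : (1 - θ) * x ≤ θ * P.real Uᶜ + 2 * θ * η := by nlinarith [hx2]
    have h3 : (1 - θ) * P.real Majᶜ ≤ (1 - θ) * (2 * η) :=
      mul_le_mul_of_nonneg_left hMajc (sub_nonneg.2 hθ1)
    nlinarith [h1, h2, h3]
  · have h1 : (1 - θ) * P.real F ≤ 0 :=
      mul_nonpos_of_nonpos_of_nonneg (by linarith) hF0
    nlinarith [h1, mul_nonneg hθ hUc0]

/-- **Ratio form.**  If some relay `a₀ ∈ A` has `P(o ↮ a₀) ≤ R · P(o ↮ A)` with `1 ≤ R`, then for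
every `d₀`, `P(d₀ < N ∧ 2N ≤ |A|) ≤ R · (2η + P(o ↮ A))`: the registered stub holds with constant
`2R` for every observer anchored by one relay; the residual is the hub regime
`P(o ↮ a) > R · P(o ↮ A)` for all `a ∈ A`. [cite: VandenbergHaggstromKahn2005, Thm. 1.4 (p. 7)] -/
theorem fatMinority_anchoredRelay_ratio {n : ℕ} (w : Sym2 (Fin n) → unitInterval)
    (A : Finset (Fin n)) (o a₀ : Fin n) (d₀ : ℕ) (η R : ℝ) (hR : 1 ≤ R) (ha₀ : a₀ ∈ A) (hoA : o ∉ A)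
    (hratio : (prodBernoulli w).real (openConn o a₀ : Set (BondConfig (Fin n)))ᶜ ≤
      R * (prodBernoulli w).real (⋃ a' ∈ A, (openConn o a' : Set (BondConfig (Fin n))))ᶜ)
    (hpair : ∀ a ∈ A, ∀ a' ∈ A, (prodBernoulli w).real (openConn a a' : Set (BondConfig (Fin n)))ᶜ ≤ η) :
    (prodBernoulli w).real {ω : BondConfig (Fin n) |
        d₀ < (A.filter fun a => ω ∈ openConn o a).card ∧
          2 * (A.filter fun a => ω ∈ openConn o a).card ≤ A.card} ≤
      R * (2 * η + (prodBernoulli w).real (⋃ a' ∈ A, (openConn o a' : Set (BondConfig (Fin n))))ᶜ) := by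
  have hmeas : ∀ s : Set (BondConfig (Fin n)), MeasurableSet s :=
    fun _ => MeasurableSet.of_discrete
  set P := prodBernoulli w with hP
  set D : Set (BondConfig (Fin n)) := (openConn o a₀ : Set (BondConfig (Fin n)))ᶜ with hD
  set U : Set (BondConfig (Fin n)) := ⋃ a' ∈ A, (openConn o a' : Set (BondConfig (Fin n))) with hU
  have hη0 : 0 ≤ η := le_trans measureReal_nonneg (hpair a₀ ha₀ a₀ ha₀)
  have hRpos : 0 < R := lt_of_lt_of_le one_pos hR
  -- `θ := 1 − 1/R` anchors: `μ(D ∩ U) = μ(D) − μ(Uᶜ) ≤ μ(D) − μ(D)/R = θ μ(D)`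
  set θ : ℝ := 1 - 1 / R with hθ
  have hθ0 : 0 ≤ θ := by
    rw [hθ, sub_nonneg, div_le_one hRpos]; exact hR
  have hUc_sub : Uᶜ ⊆ D := by
    intro ω hω hoa₀
    exact hω (Set.mem_biUnion (Finset.mem_coe.2 ha₀) hoa₀)
  have hsplit : P.real (D ∩ U) = P.real D - P.real Uᶜ := by
    have hDeq : D = (D ∩ U) ∪ Uᶜ := by
      ext ω
      constructor
      · intro hω
        by_cases hωU : ω ∈ U
        · exact Or.inl ⟨hω, hωU⟩
        · exact Or.inr hωU
      · rintro (hω | hω)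
        · exact hω.1
        · exact hUc_sub hω
    have hdisj : Disjoint (D ∩ U) Uᶜ := by
      rw [Set.disjoint_left]
      rintro ω ⟨-, hωU⟩ hωUc
      exact hωUc hωU
    have h := measureReal_union (μ := P) hdisj (hmeas Uᶜ)
    rw [← hDeq] at h
    linarith
  have hdom : P.real (D ∩ U) ≤ θ * P.real D := by
    rw [hsplit, hθ]
    have : P.real D / R ≤ P.real Uᶜ := by
      rw [div_le_iff₀ hRpos]
      calc P.real D ≤ R * P.real Uᶜ := hratio
        _ = P.real Uᶜ * R := mul_comm _ _
    have hDR : (1 - 1 / R) * P.real D = P.real D - P.real D / R := by ring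
    linarith
  have key := fatMinority_anchoredRelay w A o a₀ η θ hθ0 ha₀ hoA hdom hpair
  have h1θ : 1 - θ = 1 / R := by rw [hθ]; ring
  rw [h1θ] at key
  have hmono : P.real {ω : BondConfig (Fin n) |
        d₀ < (A.filter fun a => ω ∈ openConn o a).card ∧
          2 * (A.filter fun a => ω ∈ openConn o a).card ≤ A.card} ≤
      P.real {ω : BondConfig (Fin n) |
        0 < (A.filter fun a => ω ∈ openConn o a).card ∧
          2 * (A.filter fun a => ω ∈ openConn o a).card ≤ A.card} :=
    measureReal_mono (fun ω hω => ⟨lt_of_le_of_lt (Nat.zero_le _) hω.1, hω.2⟩) (measure_ne_top _ _)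
  have hθ1 : θ ≤ 1 := by rw [hθ]; linarith [one_div_pos.2 hRpos]
  have hUc0 : 0 ≤ P.real Uᶜ := measureReal_nonneg
  -- from `(1/R) μ(F₀) ≤ 2η + θ μ(Uᶜ) ≤ 2η + μ(Uᶜ)` multiply by `R`
  have key' : P.real {ω : BondConfig (Fin n) |
        0 < (A.filter fun a => ω ∈ openConn o a).card ∧
          2 * (A.filter fun a => ω ∈ openConn o a).card ≤ A.card} ≤ R * (2 * η + P.real Uᶜ) := by
    have h2 : 1 / R * P.real {ω : BondConfig (Fin n) |
        0 < (A.filter fun a => ω ∈ openConn o a).card ∧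
          2 * (A.filter fun a => ω ∈ openConn o a).card ≤ A.card} ≤ 2 * η + P.real Uᶜ :=
      key.trans (by nlinarith)
    have h3 := mul_le_mul_of_nonneg_left h2 hRpos.le
    have hRR : R * (1 / R) = 1 := by field_simp
    calc _ = R * (1 / R * P.real {ω : BondConfig (Fin n) |
          0 < (A.filter fun a => ω ∈ openConn o a).card ∧
            2 * (A.filter fun a => ω ∈ openConn o a).card ≤ A.card}) := by
            rw [← mul_assoc, hRR, one_mul]
      _ ≤ R * (2 * η + P.real Uᶜ) := h3
  exact hmono.trans key'

end Summit.CriticalPhenomena.PercolationContinuityZ3.Theorems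

end
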